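import Mathlib
import HarnessLib
import Summits.HubbardSuperconductivity.HubbardSuperconductivity.Theorems.KLProgrammeC4aFoldBoxLawRows
import Summits.HubbardSuperconductivity.HubbardSuperconductivity.Theorems.KLProgrammeC4aFoldBoxPreLawAllLevelsAbs

/-!
# Route `KLProgramme` — crux C4a, S3 brick (B4) «(U1)-LAWS» — PRIMED SIBLING of `…aFoldBoxLawRows`: the three law rows of a near-caustic box with the TWO-SIDED support row and the flatness row over the box's angles (`+B_fl`)

Cell `gate-hubbard-kl`, seat hubbard-kl-k3c3-p1 (g16; row «δμ-flow with klAngularMean constant piece»), by the pen's (R319)(E) ruling «RE-QUANTIFICATION = GO as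
PRIMED SIBLINGS, owner k3c3-p1» (k3c3-p3 g32, author of the original, is closed).  Located points of the 02:05Z bus line (memo
HOME/hubbard-kl-k3c3-p1/g16-M1-NEG-PRE-KERNEL.md §6–§8), the ONLY changes w.r.t. the original statement:
* (L2′) `hsupp : ∀ e ∈ [lo,hi], ∀ u, |u| ≤ q_s·e → (Kr e)′u = 0` with `q_s ≥ 3/2` (the two-sided support zone of a genuine finer-line partition piece; true for the
  physical family `…C4aPPKernelFamily.ppFamilyKernel` with `q_s = (1−t₁)/t₁`, `t₁ ≤ 2/5`);
* (L1′) `hflat : ∀ ϑ ∈ [α,β], ∀ y ∈ [φa,φb], |∫_{lo..hi} wt·(Kr e)′(D(ϑ,y) − e)| ≤ A_fl·lo/max(D(ϑ,y),lo)² + B_fl`, `B_fl ≥ 0` — asked only at the box's own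
  anti-diagonal levels `D(ϑ,y) = e_K(S(ϑ) − Φ(0,y+θ))` (beyond `hi/t₁` the box-truncated flatness is `hi/D²`-class, unsatisfiable n-free), with an additive slot that
  rides the `B` row: every `(φb − φa)`-coefficient `(… + 4Wκ²X_L)` becomes `(… + 4Wκ²X_L + X₀·B_fl)`.
Everything else — hypotheses, constants, proof — is the original verbatim (calling the primed predecessors).  `3` occurrence(s) of the `B` row re-keyed.
Sizes binder shape; nothing asserts (C), K3 or superconductivity.
References: FST II CPAM 51 (1998) §3 [cite: FeldmanSalmhoferTrubowitz1998]; Salmhofer 1999 §4.5.3 [cite: Salmhofer1999].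
-/

noncomputable section

namespace Summit.HubbardSuperconductivity.HubbardSuperconductivity.Theorems.C4a

set_option linter.dupNamespace false -- summit = problem name (single-conjunct summit), D-0017

open Real Set MeasureTheory intervalIntegral
open Literature.MathematicalPhysics.QuantumLattice Literature.MathematicalPhysics.QuantumLattice.BandSectorCounting
open Literature.MathematicalPhysics.QuantumLattice.FermiRG
open Summit.HubbardSuperconductivity.HubbardSuperconductivity.Theorems.KLRegimeSplit
open Summit.HubbardSuperconductivity.HubbardSuperconductivity.Theorems.DispersionFlow
open Summit.HubbardSuperconductivity.HubbardSuperconductivity.Theorems.PerturbedFermiCurve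

section Sizes

variable {K : TrigPolyC4v} {A : ℝ} (hA : ∀ p : Momentum, ∀ j ≤ 2, ‖iteratedFDeriv ℝ j (frameShift K) p‖ ≤ A) (hA20 : A ≤ 1 / 20)
  (hd : klCurveD ≤ (bandBounds (show (-4 : ℝ) < -1.1 by norm_num) (show (-1.1 : ℝ) ≤ -0.1 by norm_num)
    (show (-0.1 : ℝ) < 0 by norm_num)).Dtmin - 2 * A)
  {μ r : ℝ} (hr : 0 < r) (hlo : (-1.1 : ℝ) < μ - r - A) (hhi : μ + r + A < -0.1)
  {A₃ A₄ : ℝ} (hA₃ : ∀ p : Momentum, ‖iteratedFDeriv ℝ 3 (frameShift K) p‖ ≤ A₃)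
  (hA₄ : ∀ p : Momentum, ‖iteratedFDeriv ℝ 4 (frameShift K) p‖ ≤ A₄)
  {K₁ K₂ K₃ : ℝ} (hK₁ : ∀ p : Momentum, ‖fderiv ℝ (frameLevel μ K) p‖ ≤ K₁) (hK₂ : ∀ p : Momentum, ‖iteratedFDeriv ℝ 2 (frameLevel μ K) p‖ ≤ K₂)
  (hK₃ : ∀ p : Momentum, ‖iteratedFDeriv ℝ 3 (frameLevel μ K) p‖ ≤ K₃)
include hA hA20 hd hr hlo hhi hA₃ hA₄ hK₁ hK₂ hK₃

set_option maxHeartbeats 400000 in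
/-- **PRIMED SIBLING of `foldBox_law_rows`** (pen (R319)(E)): support row two-sided (`|u| ≤ q_s·e`, `q_s ≥ 3/2`), flatness row over the box's angles with `+ B_fl`;
every `B` row gains `X₀·B_fl`; otherwise the original statement and proof. -/
theorem foldBox_law_rows_abs {Kc r₀ g₀ w : ℝ} (hG : GeomConstants (frameLevel μ K) Kc r₀ g₀ w) {ρ : ℝ} (hρ : |ρ| < r) (θ : ℝ) (m : Fin 2 → ℤ)
    {α β φa φb ϑ₁ φ₁ τ₀ lo hi Wφ Wm qs Δ K₀ X₀ X₁ XL W Afl Bfl Mρ Γ Γ' : ℝ} {Kr X : ℝ → ℝ → ℝ} {wt ρm : ℝ → ℝ}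
    (hϑ₁ : ϑ₁ ∈ Icc α β) (hφ₁ : φ₁ ∈ Icc φa φb)
    (hτ : ‖levelPoint μ K 0 θ - WithLp.toLp 2 (fun i => 2 * π * (m i : ℝ)) + (levelPoint μ K ρ (ϑ₁ + θ) - levelPoint μ K 0 (φ₁ + θ)) -
      levelPoint μ K 0 (φ₁ + θ)‖ ≤ τ₀)
    (hWφ : φb - φa ≤ Wφ) (hWmα : Wm ≤ φ₁ - φa) (hWmβ : Wm ≤ φb - φ₁)
    (hmod : K₃ * (τ₀ + msD A₃ A₄ 1 * (β - α) +
              hi / ((bandBounds (show (-4 : ℝ) < -1.1 by norm_num) (show (-1.1 : ℝ) ≤ -0.1 by norm_num) (show (-0.1 : ℝ) < 0 by norm_num)).Dtmin - 2 * A) +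
              msD A₃ A₄ 1 * Wφ) * msD A₃ A₄ 1 ^ 2 +
          K₂ * (radialRowOneConst A ((bandBounds (show (-4 : ℝ) < -1.1 by norm_num) (show (-1.1 : ℝ) ≤ -0.1 by norm_num) (show (-0.1 : ℝ) < 0 by norm_num)).Dtmin -
                2 * A) * hi + msD A₃ A₄ 2 * Wφ) * (msD A₃ A₄ 1 + msD A₃ A₄ 1) +
          K₂ * (τ₀ + msD A₃ A₄ 1 * (β - α) +
              hi / ((bandBounds (show (-4 : ℝ) < -1.1 by norm_num) (show (-1.1 : ℝ) ≤ -0.1 by norm_num) (show (-0.1 : ℝ) < 0 by norm_num)).Dtmin - 2 * A) +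
              msD A₃ A₄ 1 * Wφ) * msD A₃ A₄ 2 +
          K₁ * ((uRowTwoConst A A₃ ((bandBounds (show (-4 : ℝ) < -1.1 by norm_num) (show (-1.1 : ℝ) ≤ -0.1 by norm_num) (show (-0.1 : ℝ) < 0 by norm_num)).Dtmin -
                  2 * A) +
                1 / ((bandBounds (show (-4 : ℝ) < -1.1 by norm_num) (show (-1.1 : ℝ) ≤ -0.1 by norm_num) (show (-0.1 : ℝ) < 0 by norm_num)).Dtmin - 2 * A) +
                2 * (radialRowOneConst A ((bandBounds (show (-4 : ℝ) < -1.1 by norm_num) (show (-1.1 : ℝ) ≤ -0.1 by norm_num)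
                    (show (-0.1 : ℝ) < 0 by norm_num)).Dtmin - 2 * A) -
                  1 / ((bandBounds (show (-4 : ℝ) < -1.1 by norm_num) (show (-1.1 : ℝ) ≤ -0.1 by norm_num) (show (-0.1 : ℝ) < 0 by norm_num)).Dtmin - 2 * A))) *
              hi + msD A₃ A₄ 3 * Wφ) ≤
        w * (bandBounds (show (-4 : ℝ) < -1.1 by norm_num) (show (-1.1 : ℝ) ≤ -0.1 by norm_num) (show (-0.1 : ℝ) < 0 by norm_num)).umin ^ 2)
    (hsl : K₂ * msD A₃ A₄ 1 * (τ₀ + msD A₃ A₄ 1 * (β - α) +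
        2 * (hi / ((bandBounds (show (-4 : ℝ) < -1.1 by norm_num) (show (-1.1 : ℝ) ≤ -0.1 by norm_num) (show (-0.1 : ℝ) < 0 by norm_num)).Dtmin - 2 * A))) ≤
      w * (bandBounds (show (-4 : ℝ) < -1.1 by norm_num) (show (-1.1 : ℝ) ≤ -0.1 by norm_num) (show (-0.1 : ℝ) < 0 by norm_num)).umin ^ 2 * Wm)
    (hrt : K₂ * (τ₀ + msD A₃ A₄ 1 * (β - α) +
          2 * (hi / ((bandBounds (show (-4 : ℝ) < -1.1 by norm_num) (show (-1.1 : ℝ) ≤ -0.1 by norm_num) (show (-0.1 : ℝ) < 0 by norm_num)).Dtmin - 2 * A) +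
            msD A₃ A₄ 1 * Wφ)) /
        ((bandBounds (show (-4 : ℝ) < -1.1 by norm_num) (show (-1.1 : ℝ) ≤ -0.1 by norm_num) (show (-0.1 : ℝ) < 0 by norm_num)).Dtmin - 2 * A) ≤ 1 / 2)
    (hlo0 : 0 < lo) (hlohi : lo ≤ hi) (hhir : hi < r) (hqs : 3 / 2 ≤ qs) (hX₀ : 0 ≤ X₀) (hX₁ : 0 ≤ X₁) (hXL : 0 ≤ XL) (hW : 0 ≤ W) (hAfl : 0 ≤ Afl) (hBfl : 0 ≤ Bfl)
    (hK₀ : ∀ p : Momentum, |frameLevel μ K p| ≤ K₀) (hK₀pos : 0 < K₀) (hΓ₁ : K₀ ≤ Γ) (hΓ₂ : hi / 2 ≤ Γ) (hΓ'₁ : K₀ ≤ Γ')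
    (hΓ'₂ : w * (bandBounds (show (-4 : ℝ) < -1.1 by norm_num) (show (-1.1 : ℝ) ≤ -0.1 by norm_num) (show (-0.1 : ℝ) < 0 by norm_num)).umin ^ 2 / 2 * (φb - φa) ^ 2 ≤ Γ')
    (hΔ : τ₀ + msD A₃ A₄ 1 * (β - α) + 2 * (msD A₃ A₄ 1 * Wφ) ≤ Δ) (hΔ1 : Δ ≤ 3 / 10) (hΔu : Δ ≤ (bandBounds (show (-4 : ℝ) < -1.1 by norm_num) (show (-1.1 : ℝ) ≤ -0.1 by norm_num) (show (-0.1 : ℝ) < 0 by norm_num)).umin) (hΔr : K₁ * Δ < r)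
    (hKd : ∀ e ∈ Icc (-hi) hi, e ≠ 0 → ContDiff ℝ 1 (Kr e)) (hK2d : ∀ e ∈ Icc lo hi, ContDiff ℝ 2 (Kr e))
    (hK0 : ∀ e ∈ Icc (-hi) hi, e ≠ 0 → ∀ u, |Kr e u| ≤ (max |e| |u|)⁻¹)
    (hK1 : ∀ e ∈ Icc (-hi) hi, e ≠ 0 → ∀ u, |deriv (Kr e) u| ≤ (max |e| |u|)⁻¹ ^ 2)
    (hK2 : ∀ e ∈ Icc lo hi, ∀ u, |iteratedDeriv 2 (Kr e) u| ≤ (max e |u|)⁻¹ ^ 3)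
    (hsupp : ∀ e ∈ Icc lo hi, ∀ u, |u| ≤ qs * e → deriv (Kr e) u = 0) (hKc : Continuous fun p : ℝ × ℝ => deriv (Kr p.1) p.2)
    (hflat : ∀ ϑ ∈ Icc α β, ∀ y ∈ Icc φa φb,
      |∫ e in lo..hi, wt e * deriv (Kr e) (frameLevel μ K (pairSumPath μ K ρ ϑ θ 0 - levelPoint μ K 0 (y + θ)) - e)| ≤
        Afl * (lo / (max (frameLevel μ K (pairSumPath μ K ρ ϑ θ 0 - levelPoint μ K 0 (y + θ))) lo) ^ 2) + Bfl)
    (hKn1 : ∀ s ∈ Icc lo hi, ∀ u, s / 2 ≤ u → |deriv (Kr (-s)) u| ≤ ρm s * ((max (u - s) lo)⁻¹ ^ 2))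
    (hρ0 : ∀ s ∈ Icc lo hi, 0 ≤ ρm s) (hρc : ContinuousOn ρm (Icc lo hi))
    (hρtail : ∀ a ∈ Icc lo hi, ∫ s in a..hi, ρm s ≤ Mρ * (lo * (lo / a) ^ 2))
    (hKs1 : ∀ e ∈ Icc (-lo) lo, ∀ u, |deriv (Kr e) u| ≤ (max lo |u|)⁻¹ ^ 2)
    (hXd : ∀ e ∈ Icc (-hi) hi, ContDiff ℝ 1 (X e)) (hX2 : ContinuousOn (fun p : ℝ × ℝ => X p.1 p.2) (Icc (-hi) hi ×ˢ univ))
    (hXb : ∀ e ∈ Icc (-hi) hi, ∀ v ∈ Icc φa φb, |X e v| ≤ X₀) (hX₁b : ∀ e ∈ Icc (-hi) hi, ∀ v ∈ Icc φa φb, |deriv (X e) v| ≤ X₁)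
    (hXα : ∀ e ∈ Icc (-hi) hi, X e φa = 0) (hXβ : ∀ e ∈ Icc (-hi) hi, X e φb = 0)
    (hXLip : ∀ e ∈ Icc lo hi, ∀ v ∈ Icc φa φb, |X e v - X lo v| ≤ XL * |e - lo|)
    (hwc : ContinuousOn wt (Icc (-hi) hi)) (hw0 : ∀ e ∈ Icc (-hi) hi, 0 ≤ wt e) (hwW : ∀ e ∈ Icc (-hi) hi, wt e ≤ W) :
    (∀ ϑ ∈ Ioo α β, sInf ((fun φ => frameLevel μ K (levelPoint μ K 0 θ - WithLp.toLp 2 (fun i => 2 * π * (m i : ℝ)) + (levelPoint μ K ρ (ϑ + θ) - levelPoint μ K 0 (φ + θ)))) '' Icc φa φb) ≠ 0 →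
      |∫ e in (-hi)..hi, ∫ v in φa..φb, wt e * (X e v * deriv (Kr e) (frameLevel μ K (pairSumPath μ K ρ ϑ θ 0 - levelPoint μ K e (v + θ))))| ≤
        2 * (      3 * W * ((4 + 2 * (3 / 2 : ℝ) + 1 / 2) / (1 / 2)) *
          (X₀ * (4 / Real.sqrt (2 * (K₂ * msD A₃ A₄ 1 ^ 2) +
                    w * (bandBounds (show (-4 : ℝ) < -1.1 by norm_num) (show (-1.1 : ℝ) ≤ -0.1 by norm_num) (show (-0.1 : ℝ) < 0 by norm_num)).umin ^ 2) +
                  16 * Real.sqrt (2 * (K₂ * msD A₃ A₄ 1 ^ 2) +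
                        w * (bandBounds (show (-4 : ℝ) < -1.1 by norm_num) (show (-1.1 : ℝ) ≤ -0.1 by norm_num) (show (-0.1 : ℝ) < 0 by norm_num)).umin ^ 2) /
                      (w * (bandBounds (show (-4 : ℝ) < -1.1 by norm_num) (show (-1.1 : ℝ) ≤ -0.1 by norm_num) (show (-0.1 : ℝ) < 0 by norm_num)).umin ^ 2) +
                  64 * (2 * (K₂ * msD A₃ A₄ 1 ^ 2) +
                          w * (bandBounds (show (-4 : ℝ) < -1.1 by norm_num) (show (-1.1 : ℝ) ≤ -0.1 by norm_num) (show (-0.1 : ℝ) < 0 by norm_num)).umin ^ 2) ^ 2 *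
                      Real.sqrt (2 * (K₂ * msD A₃ A₄ 1 ^ 2) +
                          w * (bandBounds (show (-4 : ℝ) < -1.1 by norm_num) (show (-1.1 : ℝ) ≤ -0.1 by norm_num) (show (-0.1 : ℝ) < 0 by norm_num)).umin ^ 2) /
                    (w * (bandBounds (show (-4 : ℝ) < -1.1 by norm_num) (show (-1.1 : ℝ) ≤ -0.1 by norm_num) (show (-0.1 : ℝ) < 0 by norm_num)).umin ^ 2) ^ 3) *
              Real.sqrt (4 + 2 * (3 / 2 : ℝ) + 1 / 2) +
            32 * X₁ * (2 * (K₂ * msD A₃ A₄ 1 ^ 2) +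
                  w * (bandBounds (show (-4 : ℝ) < -1.1 by norm_num) (show (-1.1 : ℝ) ≤ -0.1 by norm_num) (show (-0.1 : ℝ) < 0 by norm_num)).umin ^ 2) /
              (w * (bandBounds (show (-4 : ℝ) < -1.1 by norm_num) (show (-1.1 : ℝ) ≤ -0.1 by norm_num) (show (-0.1 : ℝ) < 0 by norm_num)).umin ^ 2) ^ 2)) *
          ((1 + log⁺ (Γ / |sInf ((fun φ => frameLevel μ K (levelPoint μ K 0 θ - WithLp.toLp 2 (fun i => 2 * π * (m i : ℝ)) + (levelPoint μ K ρ (ϑ + θ) - levelPoint μ K 0 (φ + θ)))) '' Icc φa φb)|)) ^ 2 *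
          (1 + (Real.sqrt |sInf ((fun φ => frameLevel μ K (levelPoint μ K 0 θ - WithLp.toLp 2 (fun i => 2 * π * (m i : ℝ)) + (levelPoint μ K ρ (ϑ + θ) - levelPoint μ K 0 (φ + θ)))) '' Icc φa φb)|)⁻¹))) ∧
    (∀ ϑ ∈ Ioo α β, 0 < sInf ((fun φ => frameLevel μ K (levelPoint μ K 0 θ - WithLp.toLp 2 (fun i => 2 * π * (m i : ℝ)) + (levelPoint μ K ρ (ϑ + θ) - levelPoint μ K 0 (φ + θ)))) '' Icc φa φb) →
      |∫ e in (-hi)..hi, ∫ v in φa..φb, wt e * (X e v * deriv (Kr e) (frameLevel μ K (pairSumPath μ K ρ ϑ θ 0 - levelPoint μ K e (v + θ))))| ≤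
              32 * (X₀ * Afl + 5 * (W * X₀ * Mρ) + 32 * (W * X₀)) / (3 * Real.sqrt (w * (bandBounds (show (-4 : ℝ) < -1.1 by norm_num) (show (-1.1 : ℝ) ≤ -0.1 by norm_num) (show (-0.1 : ℝ) < 0 by norm_num)).umin ^ 2 / 2)) *
          (lo * ((max |sInf ((fun φ => frameLevel μ K (levelPoint μ K 0 θ - WithLp.toLp 2 (fun i => 2 * π * (m i : ℝ)) + (levelPoint μ K ρ (ϑ + θ) - levelPoint μ K 0 (φ + θ)))) '' Icc φa φb)| lo)⁻¹ *
            (Real.sqrt (max |sInf ((fun φ => frameLevel μ K (levelPoint μ K 0 θ - WithLp.toLp 2 (fun i => 2 * π * (m i : ℝ)) + (levelPoint μ K ρ (ϑ + θ) - levelPoint μ K 0 (φ + θ)))) '' Icc φa φb)| lo))⁻¹)) +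
        ((64 * W * (1 / (qs + 1 / 2)) ^ 2 * X₀ *
                (K₂ / ((bandBounds (show (-4 : ℝ) < -1.1 by norm_num) (show (-1.1 : ℝ) ≤ -0.1 by norm_num) (show (-0.1 : ℝ) < 0 by norm_num)).Dtmin - 2 * A)) *
              ((1 / ((bandBounds (show (-4 : ℝ) < -1.1 by norm_num) (show (-1.1 : ℝ) ≤ -0.1 by norm_num) (show (-0.1 : ℝ) < 0 by norm_num)).Dtmin - 2 * A) +
                  msD A₃ A₄ 1 * (π * (4 + 2 * A) * Kc /
                    ((bandBounds (show (-4 : ℝ) < -1.1 by norm_num) (show (-1.1 : ℝ) ≤ -0.1 by norm_num) (show (-0.1 : ℝ) < 0 by norm_num)).umin * w *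
                      ((bandBounds (show (-4 : ℝ) < -1.1 by norm_num) (show (-1.1 : ℝ) ≤ -0.1 by norm_num) (show (-0.1 : ℝ) < 0 by norm_num)).Dtmin - 2 * A) ^ 2))) +
                2 * (1 / (qs + 1 / 2)) /
                  ((bandBounds (show (-4 : ℝ) < -1.1 by norm_num) (show (-1.1 : ℝ) ≤ -0.1 by norm_num) (show (-0.1 : ℝ) < 0 by norm_num)).Dtmin - 2 * A)) +
            4 * W * (1 / (qs + 1 / 2)) ^ 2 * XL + X₀ * Bfl) * (φb - φa) +
          8 * (128 * W * (1 / (qs + 1 / 2)) ^ 2 * X₀ *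
                (K₂ / ((bandBounds (show (-4 : ℝ) < -1.1 by norm_num) (show (-1.1 : ℝ) ≤ -0.1 by norm_num) (show (-0.1 : ℝ) < 0 by norm_num)).Dtmin - 2 * A)) *
              msD A₃ A₄ 1) /
            (w * (bandBounds (show (-4 : ℝ) < -1.1 by norm_num) (show (-1.1 : ℝ) ≤ -0.1 by norm_num) (show (-0.1 : ℝ) < 0 by norm_num)).umin ^ 2 / 2) * Real.log 2) +
                4 * (128 * W * (1 / (qs + 1 / 2)) ^ 2 * X₀ *
              (K₂ / ((bandBounds (show (-4 : ℝ) < -1.1 by norm_num) (show (-1.1 : ℝ) ≤ -0.1 by norm_num) (show (-0.1 : ℝ) < 0 by norm_num)).Dtmin - 2 * A)) *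
            msD A₃ A₄ 1) /
          (w * (bandBounds (show (-4 : ℝ) < -1.1 by norm_num) (show (-1.1 : ℝ) ≤ -0.1 by norm_num) (show (-0.1 : ℝ) < 0 by norm_num)).umin ^ 2 / 2) *
          Real.log (Γ' / |sInf ((fun φ => frameLevel μ K (levelPoint μ K 0 θ - WithLp.toLp 2 (fun i => 2 * π * (m i : ℝ)) + (levelPoint μ K ρ (ϑ + θ) - levelPoint μ K 0 (φ + θ)))) '' Icc φa φb)|)) ∧
    (∀ ϑ ∈ Ioo α β, sInf ((fun φ => frameLevel μ K (levelPoint μ K 0 θ - WithLp.toLp 2 (fun i => 2 * π * (m i : ℝ)) + (levelPoint μ K ρ (ϑ + θ) - levelPoint μ K 0 (φ + θ)))) '' Icc φa φb) < 0 →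
      |∫ e in (-hi)..hi, ∫ v in φa..φb, wt e * (X e v * deriv (Kr e) (frameLevel μ K (pairSumPath μ K ρ ϑ θ 0 - levelPoint μ K e (v + θ))))| ≤
        2 * (      W * (X₀ * (4 / Real.sqrt (2 * (K₂ * msD A₃ A₄ 1 ^ 2) +
                    w * (bandBounds (show (-4 : ℝ) < -1.1 by norm_num) (show (-1.1 : ℝ) ≤ -0.1 by norm_num) (show (-0.1 : ℝ) < 0 by norm_num)).umin ^ 2) + 16 * Real.sqrt (2 * (K₂ * msD A₃ A₄ 1 ^ 2) +
                    w * (bandBounds (show (-4 : ℝ) < -1.1 by norm_num) (show (-1.1 : ℝ) ≤ -0.1 by norm_num) (show (-0.1 : ℝ) < 0 by norm_num)).umin ^ 2) / (w * (bandBounds (show (-4 : ℝ) < -1.1 by norm_num) (show (-1.1 : ℝ) ≤ -0.1 by norm_num) (show (-0.1 : ℝ) < 0 by norm_num)).umin ^ 2) + 64 * (2 * (K₂ * msD A₃ A₄ 1 ^ 2) +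
                    w * (bandBounds (show (-4 : ℝ) < -1.1 by norm_num) (show (-1.1 : ℝ) ≤ -0.1 by norm_num) (show (-0.1 : ℝ) < 0 by norm_num)).umin ^ 2) ^ 2 * Real.sqrt (2 * (K₂ * msD A₃ A₄ 1 ^ 2) +
                    w * (bandBounds (show (-4 : ℝ) < -1.1 by norm_num) (show (-1.1 : ℝ) ≤ -0.1 by norm_num) (show (-0.1 : ℝ) < 0 by norm_num)).umin ^ 2) / (w * (bandBounds (show (-4 : ℝ) < -1.1 by norm_num) (show (-1.1 : ℝ) ≤ -0.1 by norm_num) (show (-0.1 : ℝ) < 0 by norm_num)).umin ^ 2) ^ 3 +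
              2 * Real.sqrt (w * (bandBounds (show (-4 : ℝ) < -1.1 by norm_num) (show (-1.1 : ℝ) ≤ -0.1 by norm_num) (show (-0.1 : ℝ) < 0 by norm_num)).umin ^ 2) / (w * (bandBounds (show (-4 : ℝ) < -1.1 by norm_num) (show (-1.1 : ℝ) ≤ -0.1 by norm_num) (show (-0.1 : ℝ) < 0 by norm_num)).umin ^ 2) + (2 * (K₂ * msD A₃ A₄ 1 ^ 2) +
                    w * (bandBounds (show (-4 : ℝ) < -1.1 by norm_num) (show (-1.1 : ℝ) ≤ -0.1 by norm_num) (show (-0.1 : ℝ) < 0 by norm_num)).umin ^ 2) * Real.sqrt (w * (bandBounds (show (-4 : ℝ) < -1.1 by norm_num) (show (-1.1 : ℝ) ≤ -0.1 by norm_num) (show (-0.1 : ℝ) < 0 by norm_num)).umin ^ 2) / (w * (bandBounds (show (-4 : ℝ) < -1.1 by norm_num) (show (-1.1 : ℝ) ≤ -0.1 by norm_num) (show (-0.1 : ℝ) < 0 by norm_num)).umin ^ 2) ^ 2) +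
            X₁ * (32 * (2 * (K₂ * msD A₃ A₄ 1 ^ 2) +
                    w * (bandBounds (show (-4 : ℝ) < -1.1 by norm_num) (show (-1.1 : ℝ) ≤ -0.1 by norm_num) (show (-0.1 : ℝ) < 0 by norm_num)).umin ^ 2) * Real.sqrt (K₀ + hi) / (w * (bandBounds (show (-4 : ℝ) < -1.1 by norm_num) (show (-1.1 : ℝ) ≤ -0.1 by norm_num) (show (-0.1 : ℝ) < 0 by norm_num)).umin ^ 2) ^ 2 + (φb - φa) * Real.sqrt (w * (bandBounds (show (-4 : ℝ) < -1.1 by norm_num) (show (-1.1 : ℝ) ≤ -0.1 by norm_num) (show (-0.1 : ℝ) < 0 by norm_num)).umin ^ 2) / (w * (bandBounds (show (-4 : ℝ) < -1.1 by norm_num) (show (-1.1 : ℝ) ≤ -0.1 by norm_num) (show (-0.1 : ℝ) < 0 by norm_num)).umin ^ 2))) *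
          ((4 + 2 * (3 / 2 : ℝ) + 1 / 2) * Real.sqrt (4 + 2 * (3 / 2 : ℝ) + 1 / 2) *
                ((1 + Real.log 2 + log⁺ ((1 + 4 * (2 * (K₂ * msD A₃ A₄ 1 ^ 2) +
                    w * (bandBounds (show (-4 : ℝ) < -1.1 by norm_num) (show (-1.1 : ℝ) ≤ -0.1 by norm_num) (show (-0.1 : ℝ) < 0 by norm_num)).umin ^ 2) / (w * (bandBounds (show (-4 : ℝ) < -1.1 by norm_num) (show (-1.1 : ℝ) ≤ -0.1 by norm_num) (show (-0.1 : ℝ) < 0 by norm_num)).umin ^ 2)) * (1 + (3 / 2 : ℝ))) + log⁺ (1 + 4 * (2 * (K₂ * msD A₃ A₄ 1 ^ 2) +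
                    w * (bandBounds (show (-4 : ℝ) < -1.1 by norm_num) (show (-1.1 : ℝ) ≤ -0.1 by norm_num) (show (-0.1 : ℝ) < 0 by norm_num)).umin ^ 2) / (w * (bandBounds (show (-4 : ℝ) < -1.1 by norm_num) (show (-1.1 : ℝ) ≤ -0.1 by norm_num) (show (-0.1 : ℝ) < 0 by norm_num)).umin ^ 2))) + 4) +
            2 * (1 + Real.log 2 + log⁺ ((1 + 4 * (2 * (K₂ * msD A₃ A₄ 1 ^ 2) +
                    w * (bandBounds (show (-4 : ℝ) < -1.1 by norm_num) (show (-1.1 : ℝ) ≤ -0.1 by norm_num) (show (-0.1 : ℝ) < 0 by norm_num)).umin ^ 2) / (w * (bandBounds (show (-4 : ℝ) < -1.1 by norm_num) (show (-1.1 : ℝ) ≤ -0.1 by norm_num) (show (-0.1 : ℝ) < 0 by norm_num)).umin ^ 2)) * (1 + (3 / 2 : ℝ))) + log⁺ (1 + 4 * (2 * (K₂ * msD A₃ A₄ 1 ^ 2) +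
                    w * (bandBounds (show (-4 : ℝ) < -1.1 by norm_num) (show (-1.1 : ℝ) ≤ -0.1 by norm_num) (show (-0.1 : ℝ) < 0 by norm_num)).umin ^ 2) / (w * (bandBounds (show (-4 : ℝ) < -1.1 by norm_num) (show (-1.1 : ℝ) ≤ -0.1 by norm_num) (show (-0.1 : ℝ) < 0 by norm_num)).umin ^ 2))) *
              ((4 + 2 * (3 / 2 : ℝ) + 1 / 2) / (1 / 2) * Real.sqrt ((4 + 2 * (3 / 2 : ℝ) + 1 / 2) / (1 / 2))))) *
          (Real.sqrt |sInf ((fun φ => frameLevel μ K (levelPoint μ K 0 θ - WithLp.toLp 2 (fun i => 2 * π * (m i : ℝ)) + (levelPoint μ K ρ (ϑ + θ) - levelPoint μ K 0 (φ + θ)))) '' Icc φa φb)|)⁻¹ +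
        ((64 * W * (1 / (qs + 1 / 2)) ^ 2 * X₀ *
                (K₂ / ((bandBounds (show (-4 : ℝ) < -1.1 by norm_num) (show (-1.1 : ℝ) ≤ -0.1 by norm_num) (show (-0.1 : ℝ) < 0 by norm_num)).Dtmin - 2 * A)) *
              ((1 / ((bandBounds (show (-4 : ℝ) < -1.1 by norm_num) (show (-1.1 : ℝ) ≤ -0.1 by norm_num) (show (-0.1 : ℝ) < 0 by norm_num)).Dtmin - 2 * A) +
                  msD A₃ A₄ 1 * (π * (4 + 2 * A) * Kc /
                    ((bandBounds (show (-4 : ℝ) < -1.1 by norm_num) (show (-1.1 : ℝ) ≤ -0.1 by norm_num) (show (-0.1 : ℝ) < 0 by norm_num)).umin * w *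
                      ((bandBounds (show (-4 : ℝ) < -1.1 by norm_num) (show (-1.1 : ℝ) ≤ -0.1 by norm_num) (show (-0.1 : ℝ) < 0 by norm_num)).Dtmin - 2 * A) ^ 2))) +
                2 * (1 / (qs + 1 / 2)) /
                  ((bandBounds (show (-4 : ℝ) < -1.1 by norm_num) (show (-1.1 : ℝ) ≤ -0.1 by norm_num) (show (-0.1 : ℝ) < 0 by norm_num)).Dtmin - 2 * A)) +
            4 * W * (1 / (qs + 1 / 2)) ^ 2 * XL + X₀ * Bfl) * (φb - φa) +
          8 * (128 * W * (1 / (qs + 1 / 2)) ^ 2 * X₀ *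
                (K₂ / ((bandBounds (show (-4 : ℝ) < -1.1 by norm_num) (show (-1.1 : ℝ) ≤ -0.1 by norm_num) (show (-0.1 : ℝ) < 0 by norm_num)).Dtmin - 2 * A)) *
              msD A₃ A₄ 1) /
            (w * (bandBounds (show (-4 : ℝ) < -1.1 by norm_num) (show (-1.1 : ℝ) ≤ -0.1 by norm_num) (show (-0.1 : ℝ) < 0 by norm_num)).umin ^ 2 / 2) * Real.log 2) +
                4 * (128 * W * (1 / (qs + 1 / 2)) ^ 2 * X₀ *
              (K₂ / ((bandBounds (show (-4 : ℝ) < -1.1 by norm_num) (show (-1.1 : ℝ) ≤ -0.1 by norm_num) (show (-0.1 : ℝ) < 0 by norm_num)).Dtmin - 2 * A)) *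
            msD A₃ A₄ 1) /
          (w * (bandBounds (show (-4 : ℝ) < -1.1 by norm_num) (show (-1.1 : ℝ) ≤ -0.1 by norm_num) (show (-0.1 : ℝ) < 0 by norm_num)).umin ^ 2 / 2) *
          Real.log (Γ' / |sInf ((fun φ => frameLevel μ K (levelPoint μ K 0 θ - WithLp.toLp 2 (fun i => 2 * π * (m i : ℝ)) + (levelPoint μ K ρ (ϑ + θ) - levelPoint μ K 0 (φ + θ)))) '' Icc φa φb)|)) := by
  set B := (bandBounds (show (-4 : ℝ) < -1.1 by norm_num) (show (-1.1 : ℝ) ≤ -0.1 by norm_num) (show (-0.1 : ℝ) < 0 by norm_num)) with hBdef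
  have hADt : 2 * A < B.Dtmin := by have := klCurveD_pos; linarith only [this, hd, hA20]
  have hDt : 0 < B.Dtmin - 2 * A := by linarith only [hADt]
  have hK₂0 : 0 ≤ K₂ := (norm_nonneg _).trans (hK₂ 0)
  have hA0 : 0 ≤ A := (norm_nonneg _).trans (hA 0 0 (by norm_num))
  have hKc0 : 0 ≤ Kc := (norm_nonneg _).trans (hG.norm_iteratedFDeriv_le 0 0 (by norm_num))
  have hu : 0 < B.umin := B.umin_pos
  have hwp : 0 < w := hG.wmin_pos
  have hhi0 : 0 < hi := hlo0.trans_le hlohi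
  have hφ : φa ≤ φb := hφ₁.1.trans hφ₁.2
  have hM : 0 ≤ msD A₃ A₄ 1 := (msD_one_pos A₃ A₄).le
  have hWφ' : ∀ y ∈ Icc φa φb, |y - φ₁| ≤ Wφ := fun y hy =>
    (abs_sub_le_iff.2 ⟨by linarith only [hy.2, hφ₁.1], by linarith only [hy.1, hφ₁.2]⟩ : |y - φ₁| ≤ φb - φa).trans hWφ
  -- positive-floor rows (for the pre law the floor `lo` keys the envelope in `max e |u|`)
  have habs : ∀ e ∈ Icc lo hi, |e| = e := fun e he => abs_of_pos (hlo0.trans_le he.1)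
  have hmem : ∀ e ∈ Icc lo hi, e ∈ Icc (-hi) hi ∧ e ≠ 0 := fun e he => ⟨⟨by linarith only [he.1, he.2, hlo0], he.2⟩, (hlo0.trans_le he.1).ne'⟩
  have hK1pos : ∀ e ∈ Icc lo hi, ∀ u, |deriv (Kr e) u| ≤ (max e |u|)⁻¹ ^ 2 := fun e he u => by
    have h := hK1 e (hmem e he).1 (hmem e he).2 u; rwa [habs e he] at h
  -- joint continuity of the box integrand (for Fubini and for the level layer's integrability)
  have hlev : ContinuousOn (fun p : ℝ × ℝ => levelPoint μ K p.1 p.2) ({x : ℝ | |x| < r} ×ˢ univ) :=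
    (contDiffOn_levelPoint B hA hADt hlo hhi (m := 0)).continuousOn
  have hswapθ : Continuous (fun p : ℝ × ℝ => ((p.2, p.1 + θ) : ℝ × ℝ)) := continuous_snd.prodMk (continuous_fst.add continuous_const)
  have hmapsθ : MapsTo (fun p : ℝ × ℝ => ((p.2, p.1 + θ) : ℝ × ℝ)) (univ ×ˢ Icc (-hi) hi) ({x : ℝ | |x| < r} ×ˢ univ) := fun p hp => by
    have he : p.2 ∈ Icc (-hi) hi := (mem_prod.1 hp).2
    exact mem_prod.2 ⟨abs_lt.2 ⟨by linarith only [he.1, hhir], lt_of_le_of_lt he.2 hhir⟩, mem_univ _⟩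
  have hlevθ : ContinuousOn ((fun p : ℝ × ℝ => levelPoint μ K p.1 p.2) ∘ fun p : ℝ × ℝ => ((p.2, p.1 + θ) : ℝ × ℝ)) (univ ×ˢ Icc (-hi) hi) :=
    hlev.comp hswapθ.continuousOn hmapsθ
  have hfl : Continuous (frameLevel μ K) := (EngineV8.contDiff_frameLevel μ K (n := 0)).continuous
  have hbandc : ∀ ϑ : ℝ, ContinuousOn (fun p : ℝ × ℝ => frameLevel μ K (pairSumPath μ K ρ ϑ θ 0 - levelPoint μ K p.2 (p.1 + θ))) (univ ×ˢ Icc (-hi) hi) := by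
    intro ϑ
    have h2 := hfl.comp_continuousOn ((continuousOn_const (c := pairSumPath μ K ρ ϑ θ 0)).sub hlevθ)
    exact h2.congr fun p _ => rfl
  have hΨc : ∀ ϑ : ℝ, ContinuousOn (fun p : ℝ × ℝ => X p.2 p.1 * deriv (Kr p.2) (frameLevel μ K (pairSumPath μ K ρ ϑ θ 0 - levelPoint μ K p.2 (p.1 + θ))))
      (univ ×ˢ Icc (-hi) hi) := by
    intro ϑ
    have hXs : ContinuousOn (fun p : ℝ × ℝ => X p.2 p.1) (univ ×ˢ Icc (-hi) hi) :=
      hX2.comp (continuous_snd.prodMk continuous_fst).continuousOn fun p hp => mem_prod.2 ⟨(mem_prod.1 hp).2, mem_univ _⟩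
    exact hXs.mul (hKc.comp_continuousOn (continuousOn_snd.prodMk (hbandc ϑ)))
  have hIc : ∀ ϑ : ℝ, ContinuousOn (fun e => ∫ v in φa..φb, X e v * deriv (Kr e) (frameLevel μ K (pairSumPath μ K ρ ϑ θ 0 - levelPoint μ K e (v + θ))))
      (Icc (-hi) hi) := fun ϑ =>
    Literature.Analysis.FluidPDE.continuousOn_parametric_intervalIntegral
      (H := fun p : ℝ × ℝ => X p.2 p.1 * deriv (Kr p.2) (frameLevel μ K (pairSumPath μ K ρ ϑ θ 0 - levelPoint μ K p.2 (p.1 + θ)))) (hΨc ϑ) φa φb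
  have hgi : ∀ ϑ : ℝ, IntervalIntegrable (fun e => wt e * |∫ v in φa..φb, X e v * deriv (Kr e) (frameLevel μ K (pairSumPath μ K ρ ϑ θ 0 - levelPoint μ K e (v + θ)))|)
      volume (-hi) hi := fun ϑ => by
    refine ContinuousOn.intervalIntegrable ?_
    rw [uIcc_of_le (by linarith only [hhi0] : -hi ≤ hi)]
    exact hwc.mul (continuous_abs.comp_continuousOn (hIc ϑ))
  have hrect : ∀ ϑ : ℝ, ContinuousOn (fun p : ℝ × ℝ => wt p.1 * (X p.1 p.2 * deriv (Kr p.1) (frameLevel μ K (pairSumPath μ K ρ ϑ θ 0 - levelPoint μ K p.1 (p.2 + θ)))))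
      (Icc (-hi) hi ×ˢ Icc φa φb) := by
    intro ϑ
    have h1 : ContinuousOn (fun p : ℝ × ℝ => wt p.1) (Icc (-hi) hi ×ˢ Icc φa φb) :=
      hwc.comp continuousOn_fst fun p hp => (mem_prod.1 hp).1
    have h2 : ContinuousOn (fun p : ℝ × ℝ => X p.1 p.2 * deriv (Kr p.1) (frameLevel μ K (pairSumPath μ K ρ ϑ θ 0 - levelPoint μ K p.1 (p.2 + θ))))
        (Icc (-hi) hi ×ˢ Icc φa φb) :=
      (hΨc ϑ).comp (continuous_snd.prodMk continuous_fst).continuousOn fun p hp => mem_prod.2 ⟨mem_univ _, (mem_prod.1 hp).1⟩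
    exact h1.mul h2
  -- the two glue forms of `F(ϑ)`
  have houter : ∀ ϑ : ℝ, |∫ e in (-hi)..hi, ∫ v in φa..φb, wt e * (X e v * deriv (Kr e) (frameLevel μ K (pairSumPath μ K ρ ϑ θ 0 - levelPoint μ K e (v + θ))))| ≤
      ∫ e in (-hi)..hi, wt e * |∫ v in φa..φb, X e v * deriv (Kr e) (frameLevel μ K (pairSumPath μ K ρ ϑ θ 0 - levelPoint μ K e (v + θ)))| := fun ϑ =>
    abs_intervalIntegral2_le_outer (Ψ := fun e v => X e v * deriv (Kr e) (frameLevel μ K (pairSumPath μ K ρ ϑ θ 0 - levelPoint μ K e (v + θ))))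
      (by linarith only [hhi0] : -hi ≤ hi) hw0
  have hinner : ∀ ϑ : ℝ, |∫ e in (-hi)..hi, ∫ v in φa..φb, wt e * (X e v * deriv (Kr e) (frameLevel μ K (pairSumPath μ K ρ ϑ θ 0 - levelPoint μ K e (v + θ))))| ≤
      ∫ v in φa..φb, |∫ e in (-hi)..hi, wt e * X e v * deriv (Kr e) (frameLevel μ K (pairSumPath μ K ρ ϑ θ 0 - levelPoint μ K e (v + θ)))| := fun ϑ => by
    have h := abs_intervalIntegral2_le_inner (Ψ := fun e v => X e v * deriv (Kr e) (frameLevel μ K (pairSumPath μ K ρ ϑ θ 0 - levelPoint μ K e (v + θ))))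
      (by linarith only [hhi0] : -hi ≤ hi) hφ (hrect ϑ)
    simp only [mul_assoc] at h ⊢
    exact h
  refine ⟨?_, ?_, ?_⟩
  · -- `hFlaw`
    intro ϑ hϑ hne
    have hϑI : ϑ ∈ Icc α β := Ioo_subset_Icc_self hϑ
    obtain ⟨hwin', hsl', hrt', -⟩ := foldBox_hyps_along_tile hA hA20 hd hlo hhi hA₃ hA₄ hK₁ hK₂ hK₃ hρ θ m hϑ₁ hφ₁ hτ hWφ hmod hsl hrt hϑI
    rw [sInf_sheetBase_eq] at hne ⊢
    have hδ : 0 < |sInf ((fun x : ℝ => frameLevel μ K (pairSumPath μ K ρ ϑ θ 0 - levelPoint μ K 0 (x + θ))) '' Icc φa φb)| := abs_pos.2 hne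
    have hlaw := intervalIntegral_partnerBand_twoSided_lawShape_allLevels_le hA hA20 hd hr hlo hhi hA₃ hA₄ hK₁ hK₂ hK₃ hG (pairSumPath μ K ρ ϑ θ 0) m θ
      hφ₁ hWmα hWmβ hWφ' hhi0 hhir hK₀ hK₀pos hX₀ hX₁ hW hΓ₁ hΓ₂ hδ hwin' hsl' hrt' hKd hK0 hK1 hXd hXb hX₁b hXα hXβ hw0 hwW (hgi ϑ)
    refine ((houter ϑ).trans hlaw).trans (le_of_eq ?_)
    ring
  · -- `hpre`
    intro ϑ hϑ hpos
    have hϑI : ϑ ∈ Icc α β := Ioo_subset_Icc_self hϑ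
    obtain ⟨hwin', hsl', hrt', hΔ'⟩ := foldBox_hyps_along_tile hA hA20 hd hlo hhi hA₃ hA₄ hK₁ hK₂ hK₃ hρ θ m hϑ₁ hφ₁ hτ hWφ hmod hsl hrt hϑI
    rw [sInf_sheetBase_eq] at hpos ⊢
    have hlaw := intervalIntegral_partnerBand_pre_allLevels_abs_le hA hA20 hd hr hlo hhi hA₃ hA₄ hK₁ hK₂ hK₃ hG (pairSumPath μ K ρ ϑ θ 0) m θ
      hφ₁ hWmα hWmβ hWφ' hlo0 hlohi hhir hqs hXL hAfl hBfl hK₀ hΓ'₁ hΓ'₂ hpos hwin' hsl' hrt' (hΔ'.trans hΔ) hΔ1 hΔu hΔr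
      hK2d hK1pos hK2 hsupp hKc (hflat ϑ hϑI) hKn1 hρ0 hρc hρtail hKs1 hwc hw0 hwW
      (fun y _ => hX2.comp (continuous_id.prodMk continuous_const).continuousOn fun e he => mem_prod.2 ⟨he, mem_univ _⟩)
      hXb hXLip
    exact (hinner ϑ).trans hlaw
  · -- `hpost`
    intro ϑ hϑ hneg
    have hϑI : ϑ ∈ Icc α β := Ioo_subset_Icc_self hϑ
    obtain ⟨hwin', hsl', hrt', -⟩ := foldBox_hyps_along_tile hA hA20 hd hlo hhi hA₃ hA₄ hK₁ hK₂ hK₃ hρ θ m hϑ₁ hφ₁ hτ hWφ hmod hsl hrt hϑI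
    rw [sInf_sheetBase_eq] at hneg ⊢
    have hδ : 0 < |sInf ((fun x : ℝ => frameLevel μ K (pairSumPath μ K ρ ϑ θ 0 - levelPoint μ K 0 (x + θ))) '' Icc φa φb)| := abs_pos.2 hneg.ne
    have hlaw := intervalIntegral_partnerBand_post_allLevels_le hA hA20 hd hr hlo hhi hA₃ hA₄ hK₁ hK₂ hK₃ hG (pairSumPath μ K ρ ϑ θ 0) m θ
      hφ₁ hWmα hWmβ hWφ' hhi0 hhir hK₀ hK₀pos hX₀ hX₁ hW hδ hwin' hsl' hrt' hKd hK0 hK1 hXd hXb hX₁b hXα hXβ hw0 hwW (hgi ϑ)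
    -- the `B`, `B′` rows of the pre law are nonnegative here
    have hδΓ : |sInf ((fun x : ℝ => frameLevel μ K (pairSumPath μ K ρ ϑ θ 0 - levelPoint μ K 0 (x + θ))) '' Icc φa φb)| ≤ Γ' := by
      obtain ⟨x, -, hx⟩ : sInf ((fun x : ℝ => frameLevel μ K (pairSumPath μ K ρ ϑ θ 0 - levelPoint μ K 0 (x + θ))) '' Icc φa φb) ∈
          (fun x : ℝ => frameLevel μ K (pairSumPath μ K ρ ϑ θ 0 - levelPoint μ K 0 (x + θ))) '' Icc φa φb :=
        ((isCompact_Icc.image_of_continuousOn ((contDiff_partnerBand_angle hA hd hlo hhi (pairSumPath μ K ρ ϑ θ 0)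
          (by rw [abs_zero]; exact hr) θ (m := 0)).continuous.continuousOn)).sInf_mem ((nonempty_Icc.2 hφ).image _))
      rw [← hx]; exact (hK₀ _).trans hΓ'₁
    have hlog : 0 ≤ Real.log (Γ' / |sInf ((fun x : ℝ => frameLevel μ K (pairSumPath μ K ρ ϑ θ 0 - levelPoint μ K 0 (x + θ))) '' Icc φa φb)|) :=
      Real.log_nonneg ((one_le_div hδ).2 hδΓ)
    have hB0 : 0 ≤ ((64 * W * (1 / (qs + 1 / 2)) ^ 2 * X₀ *
                (K₂ / ((bandBounds (show (-4 : ℝ) < -1.1 by norm_num) (show (-1.1 : ℝ) ≤ -0.1 by norm_num) (show (-0.1 : ℝ) < 0 by norm_num)).Dtmin - 2 * A)) *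
              ((1 / ((bandBounds (show (-4 : ℝ) < -1.1 by norm_num) (show (-1.1 : ℝ) ≤ -0.1 by norm_num) (show (-0.1 : ℝ) < 0 by norm_num)).Dtmin - 2 * A) +
                  msD A₃ A₄ 1 * (π * (4 + 2 * A) * Kc /
                    ((bandBounds (show (-4 : ℝ) < -1.1 by norm_num) (show (-1.1 : ℝ) ≤ -0.1 by norm_num) (show (-0.1 : ℝ) < 0 by norm_num)).umin * w *
                      ((bandBounds (show (-4 : ℝ) < -1.1 by norm_num) (show (-1.1 : ℝ) ≤ -0.1 by norm_num) (show (-0.1 : ℝ) < 0 by norm_num)).Dtmin - 2 * A) ^ 2))) +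
                2 * (1 / (qs + 1 / 2)) /
                  ((bandBounds (show (-4 : ℝ) < -1.1 by norm_num) (show (-1.1 : ℝ) ≤ -0.1 by norm_num) (show (-0.1 : ℝ) < 0 by norm_num)).Dtmin - 2 * A)) +
            4 * W * (1 / (qs + 1 / 2)) ^ 2 * XL + X₀ * Bfl) * (φb - φa) +
          8 * (128 * W * (1 / (qs + 1 / 2)) ^ 2 * X₀ *
                (K₂ / ((bandBounds (show (-4 : ℝ) < -1.1 by norm_num) (show (-1.1 : ℝ) ≤ -0.1 by norm_num) (show (-0.1 : ℝ) < 0 by norm_num)).Dtmin - 2 * A)) *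
              msD A₃ A₄ 1) /
            (w * (bandBounds (show (-4 : ℝ) < -1.1 by norm_num) (show (-1.1 : ℝ) ≤ -0.1 by norm_num) (show (-0.1 : ℝ) < 0 by norm_num)).umin ^ 2 / 2) * Real.log 2) := by
      have : 0 ≤ φb - φa := sub_nonneg.2 hφ
      have : 0 < Real.log 2 := Real.log_pos (by norm_num)
      positivity
    have hB'0 : 0 ≤         4 * (128 * W * (1 / (qs + 1 / 2)) ^ 2 * X₀ *
              (K₂ / ((bandBounds (show (-4 : ℝ) < -1.1 by norm_num) (show (-1.1 : ℝ) ≤ -0.1 by norm_num) (show (-0.1 : ℝ) < 0 by norm_num)).Dtmin - 2 * A)) *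
            msD A₃ A₄ 1) /
          (w * (bandBounds (show (-4 : ℝ) < -1.1 by norm_num) (show (-1.1 : ℝ) ≤ -0.1 by norm_num) (show (-0.1 : ℝ) < 0 by norm_num)).umin ^ 2 / 2) := by positivity
    have hprod := mul_nonneg hB'0 hlog
    refine ((houter ϑ).trans hlaw).trans ?_
    have hring : 2 * ((      W * (X₀ * (4 / Real.sqrt (2 * (K₂ * msD A₃ A₄ 1 ^ 2) +
                    w * (bandBounds (show (-4 : ℝ) < -1.1 by norm_num) (show (-1.1 : ℝ) ≤ -0.1 by norm_num) (show (-0.1 : ℝ) < 0 by norm_num)).umin ^ 2) + 16 * Real.sqrt (2 * (K₂ * msD A₃ A₄ 1 ^ 2) +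
                    w * (bandBounds (show (-4 : ℝ) < -1.1 by norm_num) (show (-1.1 : ℝ) ≤ -0.1 by norm_num) (show (-0.1 : ℝ) < 0 by norm_num)).umin ^ 2) / (w * (bandBounds (show (-4 : ℝ) < -1.1 by norm_num) (show (-1.1 : ℝ) ≤ -0.1 by norm_num) (show (-0.1 : ℝ) < 0 by norm_num)).umin ^ 2) + 64 * (2 * (K₂ * msD A₃ A₄ 1 ^ 2) +
                    w * (bandBounds (show (-4 : ℝ) < -1.1 by norm_num) (show (-1.1 : ℝ) ≤ -0.1 by norm_num) (show (-0.1 : ℝ) < 0 by norm_num)).umin ^ 2) ^ 2 * Real.sqrt (2 * (K₂ * msD A₃ A₄ 1 ^ 2) +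
                    w * (bandBounds (show (-4 : ℝ) < -1.1 by norm_num) (show (-1.1 : ℝ) ≤ -0.1 by norm_num) (show (-0.1 : ℝ) < 0 by norm_num)).umin ^ 2) / (w * (bandBounds (show (-4 : ℝ) < -1.1 by norm_num) (show (-1.1 : ℝ) ≤ -0.1 by norm_num) (show (-0.1 : ℝ) < 0 by norm_num)).umin ^ 2) ^ 3 +
              2 * Real.sqrt (w * (bandBounds (show (-4 : ℝ) < -1.1 by norm_num) (show (-1.1 : ℝ) ≤ -0.1 by norm_num) (show (-0.1 : ℝ) < 0 by norm_num)).umin ^ 2) / (w * (bandBounds (show (-4 : ℝ) < -1.1 by norm_num) (show (-1.1 : ℝ) ≤ -0.1 by norm_num) (show (-0.1 : ℝ) < 0 by norm_num)).umin ^ 2) + (2 * (K₂ * msD A₃ A₄ 1 ^ 2) +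
                    w * (bandBounds (show (-4 : ℝ) < -1.1 by norm_num) (show (-1.1 : ℝ) ≤ -0.1 by norm_num) (show (-0.1 : ℝ) < 0 by norm_num)).umin ^ 2) * Real.sqrt (w * (bandBounds (show (-4 : ℝ) < -1.1 by norm_num) (show (-1.1 : ℝ) ≤ -0.1 by norm_num) (show (-0.1 : ℝ) < 0 by norm_num)).umin ^ 2) / (w * (bandBounds (show (-4 : ℝ) < -1.1 by norm_num) (show (-1.1 : ℝ) ≤ -0.1 by norm_num) (show (-0.1 : ℝ) < 0 by norm_num)).umin ^ 2) ^ 2) +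
            X₁ * (32 * (2 * (K₂ * msD A₃ A₄ 1 ^ 2) +
                    w * (bandBounds (show (-4 : ℝ) < -1.1 by norm_num) (show (-1.1 : ℝ) ≤ -0.1 by norm_num) (show (-0.1 : ℝ) < 0 by norm_num)).umin ^ 2) * Real.sqrt (K₀ + hi) / (w * (bandBounds (show (-4 : ℝ) < -1.1 by norm_num) (show (-1.1 : ℝ) ≤ -0.1 by norm_num) (show (-0.1 : ℝ) < 0 by norm_num)).umin ^ 2) ^ 2 + (φb - φa) * Real.sqrt (w * (bandBounds (show (-4 : ℝ) < -1.1 by norm_num) (show (-1.1 : ℝ) ≤ -0.1 by norm_num) (show (-0.1 : ℝ) < 0 by norm_num)).umin ^ 2) / (w * (bandBounds (show (-4 : ℝ) < -1.1 by norm_num) (show (-1.1 : ℝ) ≤ -0.1 by norm_num) (show (-0.1 : ℝ) < 0 by norm_num)).umin ^ 2))) *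
          ((4 + 2 * (3 / 2 : ℝ) + 1 / 2) * Real.sqrt (4 + 2 * (3 / 2 : ℝ) + 1 / 2) *
                ((1 + Real.log 2 + log⁺ ((1 + 4 * (2 * (K₂ * msD A₃ A₄ 1 ^ 2) +
                    w * (bandBounds (show (-4 : ℝ) < -1.1 by norm_num) (show (-1.1 : ℝ) ≤ -0.1 by norm_num) (show (-0.1 : ℝ) < 0 by norm_num)).umin ^ 2) / (w * (bandBounds (show (-4 : ℝ) < -1.1 by norm_num) (show (-1.1 : ℝ) ≤ -0.1 by norm_num) (show (-0.1 : ℝ) < 0 by norm_num)).umin ^ 2)) * (1 + (3 / 2 : ℝ))) + log⁺ (1 + 4 * (2 * (K₂ * msD A₃ A₄ 1 ^ 2) +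
                    w * (bandBounds (show (-4 : ℝ) < -1.1 by norm_num) (show (-1.1 : ℝ) ≤ -0.1 by norm_num) (show (-0.1 : ℝ) < 0 by norm_num)).umin ^ 2) / (w * (bandBounds (show (-4 : ℝ) < -1.1 by norm_num) (show (-1.1 : ℝ) ≤ -0.1 by norm_num) (show (-0.1 : ℝ) < 0 by norm_num)).umin ^ 2))) + 4) +
            2 * (1 + Real.log 2 + log⁺ ((1 + 4 * (2 * (K₂ * msD A₃ A₄ 1 ^ 2) +
                    w * (bandBounds (show (-4 : ℝ) < -1.1 by norm_num) (show (-1.1 : ℝ) ≤ -0.1 by norm_num) (show (-0.1 : ℝ) < 0 by norm_num)).umin ^ 2) / (w * (bandBounds (show (-4 : ℝ) < -1.1 by norm_num) (show (-1.1 : ℝ) ≤ -0.1 by norm_num) (show (-0.1 : ℝ) < 0 by norm_num)).umin ^ 2)) * (1 + (3 / 2 : ℝ))) + log⁺ (1 + 4 * (2 * (K₂ * msD A₃ A₄ 1 ^ 2) +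
                    w * (bandBounds (show (-4 : ℝ) < -1.1 by norm_num) (show (-1.1 : ℝ) ≤ -0.1 by norm_num) (show (-0.1 : ℝ) < 0 by norm_num)).umin ^ 2) / (w * (bandBounds (show (-4 : ℝ) < -1.1 by norm_num) (show (-1.1 : ℝ) ≤ -0.1 by norm_num) (show (-0.1 : ℝ) < 0 by norm_num)).umin ^ 2))) *
              ((4 + 2 * (3 / 2 : ℝ) + 1 / 2) / (1 / 2) * Real.sqrt ((4 + 2 * (3 / 2 : ℝ) + 1 / 2) / (1 / 2))))) * (Real.sqrt |sInf ((fun x : ℝ => frameLevel μ K (pairSumPath μ K ρ ϑ θ 0 - levelPoint μ K 0 (x + θ))) '' Icc φa φb)|)⁻¹) =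
        2 * (      W * (X₀ * (4 / Real.sqrt (2 * (K₂ * msD A₃ A₄ 1 ^ 2) +
                    w * (bandBounds (show (-4 : ℝ) < -1.1 by norm_num) (show (-1.1 : ℝ) ≤ -0.1 by norm_num) (show (-0.1 : ℝ) < 0 by norm_num)).umin ^ 2) + 16 * Real.sqrt (2 * (K₂ * msD A₃ A₄ 1 ^ 2) +
                    w * (bandBounds (show (-4 : ℝ) < -1.1 by norm_num) (show (-1.1 : ℝ) ≤ -0.1 by norm_num) (show (-0.1 : ℝ) < 0 by norm_num)).umin ^ 2) / (w * (bandBounds (show (-4 : ℝ) < -1.1 by norm_num) (show (-1.1 : ℝ) ≤ -0.1 by norm_num) (show (-0.1 : ℝ) < 0 by norm_num)).umin ^ 2) + 64 * (2 * (K₂ * msD A₃ A₄ 1 ^ 2) +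
                    w * (bandBounds (show (-4 : ℝ) < -1.1 by norm_num) (show (-1.1 : ℝ) ≤ -0.1 by norm_num) (show (-0.1 : ℝ) < 0 by norm_num)).umin ^ 2) ^ 2 * Real.sqrt (2 * (K₂ * msD A₃ A₄ 1 ^ 2) +
                    w * (bandBounds (show (-4 : ℝ) < -1.1 by norm_num) (show (-1.1 : ℝ) ≤ -0.1 by norm_num) (show (-0.1 : ℝ) < 0 by norm_num)).umin ^ 2) / (w * (bandBounds (show (-4 : ℝ) < -1.1 by norm_num) (show (-1.1 : ℝ) ≤ -0.1 by norm_num) (show (-0.1 : ℝ) < 0 by norm_num)).umin ^ 2) ^ 3 +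
              2 * Real.sqrt (w * (bandBounds (show (-4 : ℝ) < -1.1 by norm_num) (show (-1.1 : ℝ) ≤ -0.1 by norm_num) (show (-0.1 : ℝ) < 0 by norm_num)).umin ^ 2) / (w * (bandBounds (show (-4 : ℝ) < -1.1 by norm_num) (show (-1.1 : ℝ) ≤ -0.1 by norm_num) (show (-0.1 : ℝ) < 0 by norm_num)).umin ^ 2) + (2 * (K₂ * msD A₃ A₄ 1 ^ 2) +
                    w * (bandBounds (show (-4 : ℝ) < -1.1 by norm_num) (show (-1.1 : ℝ) ≤ -0.1 by norm_num) (show (-0.1 : ℝ) < 0 by norm_num)).umin ^ 2) * Real.sqrt (w * (bandBounds (show (-4 : ℝ) < -1.1 by norm_num) (show (-1.1 : ℝ) ≤ -0.1 by norm_num) (show (-0.1 : ℝ) < 0 by norm_num)).umin ^ 2) / (w * (bandBounds (show (-4 : ℝ) < -1.1 by norm_num) (show (-1.1 : ℝ) ≤ -0.1 by norm_num) (show (-0.1 : ℝ) < 0 by norm_num)).umin ^ 2) ^ 2) +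
            X₁ * (32 * (2 * (K₂ * msD A₃ A₄ 1 ^ 2) +
                    w * (bandBounds (show (-4 : ℝ) < -1.1 by norm_num) (show (-1.1 : ℝ) ≤ -0.1 by norm_num) (show (-0.1 : ℝ) < 0 by norm_num)).umin ^ 2) * Real.sqrt (K₀ + hi) / (w * (bandBounds (show (-4 : ℝ) < -1.1 by norm_num) (show (-1.1 : ℝ) ≤ -0.1 by norm_num) (show (-0.1 : ℝ) < 0 by norm_num)).umin ^ 2) ^ 2 + (φb - φa) * Real.sqrt (w * (bandBounds (show (-4 : ℝ) < -1.1 by norm_num) (show (-1.1 : ℝ) ≤ -0.1 by norm_num) (show (-0.1 : ℝ) < 0 by norm_num)).umin ^ 2) / (w * (bandBounds (show (-4 : ℝ) < -1.1 by norm_num) (show (-1.1 : ℝ) ≤ -0.1 by norm_num) (show (-0.1 : ℝ) < 0 by norm_num)).umin ^ 2))) *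
          ((4 + 2 * (3 / 2 : ℝ) + 1 / 2) * Real.sqrt (4 + 2 * (3 / 2 : ℝ) + 1 / 2) *
                ((1 + Real.log 2 + log⁺ ((1 + 4 * (2 * (K₂ * msD A₃ A₄ 1 ^ 2) +
                    w * (bandBounds (show (-4 : ℝ) < -1.1 by norm_num) (show (-1.1 : ℝ) ≤ -0.1 by norm_num) (show (-0.1 : ℝ) < 0 by norm_num)).umin ^ 2) / (w * (bandBounds (show (-4 : ℝ) < -1.1 by norm_num) (show (-1.1 : ℝ) ≤ -0.1 by norm_num) (show (-0.1 : ℝ) < 0 by norm_num)).umin ^ 2)) * (1 + (3 / 2 : ℝ))) + log⁺ (1 + 4 * (2 * (K₂ * msD A₃ A₄ 1 ^ 2) +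
                    w * (bandBounds (show (-4 : ℝ) < -1.1 by norm_num) (show (-1.1 : ℝ) ≤ -0.1 by norm_num) (show (-0.1 : ℝ) < 0 by norm_num)).umin ^ 2) / (w * (bandBounds (show (-4 : ℝ) < -1.1 by norm_num) (show (-1.1 : ℝ) ≤ -0.1 by norm_num) (show (-0.1 : ℝ) < 0 by norm_num)).umin ^ 2))) + 4) +
            2 * (1 + Real.log 2 + log⁺ ((1 + 4 * (2 * (K₂ * msD A₃ A₄ 1 ^ 2) +
                    w * (bandBounds (show (-4 : ℝ) < -1.1 by norm_num) (show (-1.1 : ℝ) ≤ -0.1 by norm_num) (show (-0.1 : ℝ) < 0 by norm_num)).umin ^ 2) / (w * (bandBounds (show (-4 : ℝ) < -1.1 by norm_num) (show (-1.1 : ℝ) ≤ -0.1 by norm_num) (show (-0.1 : ℝ) < 0 by norm_num)).umin ^ 2)) * (1 + (3 / 2 : ℝ))) + log⁺ (1 + 4 * (2 * (K₂ * msD A₃ A₄ 1 ^ 2) +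
                    w * (bandBounds (show (-4 : ℝ) < -1.1 by norm_num) (show (-1.1 : ℝ) ≤ -0.1 by norm_num) (show (-0.1 : ℝ) < 0 by norm_num)).umin ^ 2) / (w * (bandBounds (show (-4 : ℝ) < -1.1 by norm_num) (show (-1.1 : ℝ) ≤ -0.1 by norm_num) (show (-0.1 : ℝ) < 0 by norm_num)).umin ^ 2))) *
              ((4 + 2 * (3 / 2 : ℝ) + 1 / 2) / (1 / 2) * Real.sqrt ((4 + 2 * (3 / 2 : ℝ) + 1 / 2) / (1 / 2))))) * (Real.sqrt |sInf ((fun x : ℝ => frameLevel μ K (pairSumPath μ K ρ ϑ θ 0 - levelPoint μ K 0 (x + θ))) '' Icc φa φb)|)⁻¹ := by ring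
    rw [hring]
    linarith only [hlaw, hB0, hprod, houter ϑ]

end Sizes

end Summit.HubbardSuperconductivity.HubbardSuperconductivity.Theorems.C4a

end
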